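import Mathlib.Analysis.InnerProductSpace.PiL2
import Mathlib.Geometry.Manifold.Instances.Sphere
import Mathlib.Analysis.Convex.GaugeRescale
import Mathlib.Topology.UnitInterval
import Mathlib.Analysis.SpecificLimits.Basic
import Mathlib.Algebra.Category.ModuleCat.Biproducts
import Literature.AlgebraicTopology.SingularHomology.ExcisionMayerVietoris
import Literature.AlgebraicTopology.SingularHomology.CompactSupport
import Literature.AlgebraicTopology.SingularHomology.PuncturedEuclidean
import HarnessLib

/-!
# Complements of embedded cubes and spheres in `𝕊ⁿ` (Hatcher, Prop. 2B.1, vanishing part)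

Trunk T-ALGTOP (singular homology). A. Hatcher, *Algebraic Topology*, CUP 2002, Prop. 2B.1:

* (a) for an embedding `h : Dᵏ → Sⁿ`, `H̃ᵢ(Sⁿ ∖ h(Dᵏ)) = 0` for all `i`;
* (b) for an embedding `h : Sᵏ → Sⁿ` with `k < n`, `H̃ᵢ(Sⁿ ∖ h(Sᵏ))` is `ℤ` for `i = n - k - 1`
  and `0` otherwise.

This file proves the **positive-degree vanishing statements** of (a) and (b) for Mathlib's
singular homology with arbitrary coefficients, modulo two consequences of the Mayer–Vietoris
sequence for open subsets `U₁`, `U₂` of the ambient space, isolated as the properties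
`MVInterVanishing R M X` and `MVInterInjectivity R M X` (so that any proof of the Mayer–Vietoris
sequence can be plugged in; here they are derived from the named facts of
`ExcisionMayerVietoris.lean` that the rest of the singular-homology library also takes as
hypotheses — excision `relativeSingularHomology.isIso_map_of_interior_union_interior` (`hexc`) and
Mayer–Vietoris exactness at `Hₙ(U ∩ V)` `mayerVietoris.exact₃` (`h₃`)) and, for (b), the homology
of spheres `isZero_singularHomology_sphere` (`hS`):

* `Literature.AlgebraicTopology.SingularHomology.SphereComplement.isZero_compl_range_cube` — (a), degrees `≠ 0`, for continuous injections
  `Iᵏ → X` into any Hausdorff space `X` whose punctured open subsets `X ∖ {x}` have no homology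
  in positive degrees (cubes `Iᵏ = (Fin k → I)` instead of discs; the two are homeomorphic);
* `Literature.AlgebraicTopology.SingularHomology.SphereComplement.isZero_compl_range_sphere`,
  `Literature.AlgebraicTopology.SingularHomology.SphereComplement.isZero_compl_range_of_isEmbedding` — (b), degrees `i ≠ 0, n - k - 1`:
  `Hᵢ(𝕊ⁿ ∖ h(𝕊ᵏ); M) = 0`. With `ℤ` coefficients this is the statement of the named fact
  `Literature.Topology.FourManifolds.isZero_singularHomology_sphere_compl_sphere` of
  `Literature/Topology/FourManifolds/GluckTwistHomology.lean` (used there at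
  `(n, k, i) = (4, 2, 2)`: `H₂(S⁴ ∖ K) = 0` for a 2-knot `K`, in the computation of the homology
  of a Gluck twist), which thereby reduces to `hexc`, `h₃`, `hS`.

## Proof (Hatcher 2002, pp. 169–170)

(a) Induction on `k`. `X ∖ h(I⁰)` is a punctured `X`. For the inductive step
(`isZero_slabCompl_univ`, stated for `h : B × I → X` with `B` compact) suppose
`α ∈ Hᵢ(X ∖ h(B × I))` is non-zero. By Mayer–Vietoris for the open cover
`X ∖ h(B × {½}) = (X ∖ h(B × [0, ½])) ∪ (X ∖ h(B × [½, 1]))`, whose intersection is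
`X ∖ h(B × I)` and whose union has `Hᵢ₊₁ = 0` by induction, `α` survives in one of the two
halves (`res_ne_zero_step`, using the injectivity criterion
`eq_zero_of_map_eq_zero_of_isZero_union`); iterating (`bisect`, `bisect_invariant`) gives nested
intervals `Jₘ` of length `2⁻ᵐ` shrinking to a point `t` (`iInter_Icc_bisect`) with `α ≠ 0` in
each `Hᵢ(X ∖ h(B × Jₘ))`. But `α` dies in `Hᵢ(X ∖ h(B × {t})) = 0` (induction), and
`X ∖ h(B × {t}) = ⋃ₘ X ∖ h(B × Jₘ)` is an increasing open union, so `α` already dies in some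
`Hᵢ(X ∖ h(B × Jₘ))` because singular homology has compact supports
(`singularHomology.exists_map_eq_zero_of_iUnion`, `CompactSupport.lean`) — a contradiction.

(b) Induction on `k`. For `k = 0`, `𝕊ⁿ ∖ {v, w} ≃ₜ ℝⁿ ∖ {0} ≃ 𝕊ⁿ⁻¹` (stereographic projection,
`sphereMinusTwoPointsHomeomorph`; radial retraction `Literature.AlgebraicTopology.SingularHomology.sphereHomotopyEquivPunctured` of
`PuncturedEuclidean.lean`). For the inductive step cover `𝕊ᵏ⁺¹` by its closed hemispheres
`D± = {±z_{k+1} ≥ 0}`, which are cubes (`hemisphere`: `Iᵏ⁺¹ ≅ closed ball ≅ D±`, the first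
homeomorphism by Mathlib's gauge rescaling
`exists_homeomorph_image_interior_closure_frontier_eq_unitBall`, the second by
`y ↦ (y, ±√(1 - ‖y‖²))`) meeting in the equator `𝕊ᵏ` (`equator`,
`range_hemisphere_inter_range_hemisphere`). Then
`𝕊ⁿ ∖ f(𝕊ᵏ) = (𝕊ⁿ ∖ f(D₊)) ∪ (𝕊ⁿ ∖ f(D₋))` with intersection `𝕊ⁿ ∖ f(𝕊ᵏ⁺¹)`; both pieces have
no positive-degree homology by (a), so Mayer–Vietoris (`isZero_inter_of_isZero_union`) gives
`Hᵢ(𝕊ⁿ ∖ f(𝕊ᵏ⁺¹)) = 0` from `Hᵢ₊₁(𝕊ⁿ ∖ f(𝕊ᵏ)) = 0`.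

## Main statements

* Geometry: `snocE`/`initE` (append/drop the last Euclidean coordinate), `equator`,
  `cubeSet`/`cubeMap`/`cubeToBall` (the unit cube and a continuous bijection onto the closed unit
  ball), `hemisphere ε` (`ε = ±1`; continuous injections `Iᵐ → 𝕊ᵐ` onto the closed hemispheres,
  `range_hemisphere`), `sphereMinusPointHomeomorph : 𝕊ⁿ ∖ {v} ≃ₜ ℝⁿ` (Mathlib's
  `stereographic'`), `sphereMinusTwoPointsHomeomorph : 𝕊ⁿ ∖ {v, w} ≃ₜ ℝⁿ ∖ {0}`, `pole` and
  `range_eq_pair_of_sphere_zero` (`𝕊⁰` has two points).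
* Mayer–Vietoris for two open subsets `U₁`, `U₂` of an ambient space:
  `isZero_inter_of_isZero_union`, `eq_zero_of_map_eq_zero_of_isZero_union` (from `hexc`, `h₃`);
  the criteria `MVInterVanishing`, `MVInterInjectivity` (the latter implies the former,
  `MVInterInjectivity.mvInterVanishing`) and their derivations
  `mvInterVanishing_of_mayerVietoris`, `mvInterInjectivity_of_mayerVietoris`.
* Bisection: `bisect`, `bisectLim`, `iInter_Icc_bisect`, `bisect_invariant`.
* Slabs: `slabCompl h J = X ∖ h(B × J)`, `res_ne_zero_step`, `isZero_slabCompl_univ`.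
* `isZero_compl_range_cube` (Prop. 2B.1(a), degrees `≠ 0`, from `MVInterInjectivity R M X`),
  `isZero_compl_singleton_sphere`, `isZero_compl_pair_sphere`, `isZero_compl_range_sphere` and
  `isZero_compl_range_of_isEmbedding_of_criteria` (Prop. 2B.1(b), degrees `≠ 0, n - k - 1`, from
  `MVInterInjectivity R M (𝕊 n)` and `hS`), `isZero_compl_range_of_isEmbedding` (the same from
  `hexc`, `h₃`, `hS`).

## References

* A. Hatcher, *Algebraic Topology*, CUP 2002, §2.2 (Mayer–Vietoris, p. 149), §2.B Prop. 2B.1,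
  Prop. 3.33 [HatcherAT2002].

## Design notes

* The inductions only use Mayer–Vietoris through `MVInterInjectivity` (and its consequence
  `MVInterVanishing`) for the ambient space (`X`, resp. the target sphere `𝕊ⁿ`); when deriving
  it from `hexc`, `h₃`, the
  latter quantify over all spaces of the universe of `X` (as in
  `Literature.Topology.FourManifolds.gluck_homeomorph_sphere_four_of_mayerVietoris`), since Mayer–Vietoris is applied in the
  subspaces `U₁ ∪ U₂`. Coefficients `R`, `M` are arbitrary.
* Only unreduced homology in positive degrees occurs, so no reduced homology is needed; the
  degree `n - k - 1` (natural subtraction) is excluded exactly as in the named fact.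
* Embeddings of compact spaces into Hausdorff spaces are the same as continuous injections; the
  inductions are phrased with `C(–, –)` and `Function.Injective`, and
  `isZero_compl_range_of_isEmbedding` converts from `Topology.IsEmbedding`.
* No declaration in this file uses `sorry`.
-/

noncomputable section

open CategoryTheory Limits Set Function Metric unitInterval

universe u v w

namespace Literature.AlgebraicTopology.SingularHomology

/-- Local notation: `𝔼 n` is the model Euclidean space `EuclideanSpace ℝ (Fin n)`. -/
local notation "𝔼 " n:arg => EuclideanSpace ℝ (Fin n)

/-- Local notation: `𝕊 n` is the unit sphere in `EuclideanSpace ℝ (Fin (n + 1))`. -/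
local notation "𝕊 " n:arg => (Metric.sphere (0 : EuclideanSpace ℝ (Fin (n + 1))) 1)

namespace SphereComplement

section Geometry


variable {m : ℕ}

/-! ### Appending and dropping the last Euclidean coordinate -/

/-- Append a last coordinate: `(y, t) ↦ (y₀, …, y_{m-1}, t)`. [folklore] -/
def snocE (y : 𝔼 m) (t : ℝ) : 𝔼 (m + 1) := WithLp.toLp 2 (Fin.snoc (fun i => y i) t)

/-- Drop the last coordinate. [folklore] -/
def initE (z : 𝔼 (m + 1)) : 𝔼 m := WithLp.toLp 2 (fun i => z i.castSucc)

/-- The first `m` coordinates of `snocE y t` are those of `y`. [folklore] -/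
@[simp]
theorem snocE_apply_castSucc (y : 𝔼 m) (t : ℝ) (i : Fin m) : snocE y t i.castSucc = y i := by
  simp [snocE]

/-- The last coordinate of `snocE y t` is `t`. [folklore] -/
@[simp]
theorem snocE_apply_last (y : 𝔼 m) (t : ℝ) : snocE y t (Fin.last m) = t := by
  simp [snocE]

/-- Coordinates of `initE z`. [folklore] -/
@[simp]
theorem initE_apply (z : 𝔼 (m + 1)) (i : Fin m) : initE z i = z i.castSucc := rfl

/-- Dropping the appended coordinate recovers `y`. [folklore] -/
@[simp]
theorem initE_snocE (y : 𝔼 m) (t : ℝ) : initE (snocE y t) = y := by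
  ext i
  simp

/-- A vector is its initial part with its last coordinate appended. [folklore] -/
theorem snocE_initE (z : 𝔼 (m + 1)) : snocE (initE z) (z (Fin.last m)) = z := by
  ext i
  induction i using Fin.lastCases with
  | last => simp
  | cast i => simp

/-- Pythagoras: `‖z‖² = ‖init z‖² + z_m²`. [folklore] -/
theorem norm_sq_eq_norm_initE_sq_add (z : 𝔼 (m + 1)) :
    ‖z‖ ^ 2 = ‖initE z‖ ^ 2 + z (Fin.last m) ^ 2 := by
  rw [EuclideanSpace.real_norm_sq_eq, EuclideanSpace.real_norm_sq_eq, Fin.sum_univ_castSucc]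
  rfl

/-- Pythagoras: `‖(y, t)‖² = ‖y‖² + t²`. [folklore] -/
theorem norm_snocE_sq (y : 𝔼 m) (t : ℝ) : ‖snocE y t‖ ^ 2 = ‖y‖ ^ 2 + t ^ 2 := by
  rw [norm_sq_eq_norm_initE_sq_add, initE_snocE, snocE_apply_last]

/-- Appending a coordinate is continuous. [folklore] -/
theorem continuous_snocE : Continuous (fun p : 𝔼 m × ℝ => snocE p.1 p.2) := by
  unfold snocE
  refine (PiLp.continuous_toLp 2 _).comp ?_
  refine Continuous.finSnoc ?_ continuous_snd
  exact continuous_pi fun i => (PiLp.continuous_apply 2 _ i).comp continuous_fst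

/-- Dropping the last coordinate is continuous. [folklore] -/
theorem continuous_initE : Continuous (initE : 𝔼 (m + 1) → 𝔼 m) := by
  unfold initE
  exact (PiLp.continuous_toLp 2 _).comp (continuous_pi fun i => PiLp.continuous_apply 2 _ _)

/-- `snocE` is injective in the vector argument. [folklore] -/
theorem snocE_injective_left {y y' : 𝔼 m} {t t' : ℝ} (h : snocE y t = snocE y' t') : y = y' := by
  simpa using congrArg initE h

/-! ### The equator `𝕊ᵐ ⊂ 𝕊ᵐ⁺¹` -/

/-- The equatorial embedding `𝕊ᵐ → 𝕊ᵐ⁺¹`, `y ↦ (y, 0)`. [folklore] -/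
def equator (y : 𝕊 m) : 𝕊 (m + 1) :=
  ⟨snocE y 0, by
    have hy : ‖(y : 𝔼 (m + 1))‖ = 1 := norm_eq_of_mem_sphere y
    have h : ‖snocE (y : 𝔼 (m + 1)) 0‖ ^ 2 = 1 := by rw [norm_snocE_sq, hy]; ring
    rw [mem_sphere_zero_iff_norm]
    nlinarith [norm_nonneg (snocE (y : 𝔼 (m + 1)) 0)]⟩

/-- The equatorial embedding on coordinates. [folklore] -/
@[simp]
theorem coe_equator (y : 𝕊 m) : (equator y : 𝔼 (m + 2)) = snocE y 0 := rfl

/-- The equatorial embedding is continuous. [folklore] -/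
theorem continuous_equator : Continuous (equator : 𝕊 m → 𝕊 (m + 1)) :=
  Continuous.subtype_mk (continuous_snocE.comp (continuous_subtype_val.prodMk continuous_const)) _

/-- The equatorial embedding is injective. [folklore] -/
theorem equator_injective : Injective (equator : 𝕊 m → 𝕊 (m + 1)) := by
  intro y y' h
  exact Subtype.ext (snocE_injective_left (congrArg Subtype.val h))

/-- The image of the equatorial embedding is the equator `{z | z_{m+1} = 0}` of `𝕊ᵐ⁺¹`. [folklore]
-/
theorem range_equator :
    range (equator : 𝕊 m → 𝕊 (m + 1)) =
      {z : 𝕊 (m + 1) | (z : 𝔼 (m + 2)) (Fin.last (m + 1)) = 0} := by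
  ext z
  constructor
  · rintro ⟨y, rfl⟩
    simp
  · intro hz
    have hz1 : ‖(z : 𝔼 (m + 2))‖ = 1 := norm_eq_of_mem_sphere z
    have hn : ‖initE (z : 𝔼 (m + 2))‖ = 1 := by
      have h := norm_sq_eq_norm_initE_sq_add (z : 𝔼 (m + 2))
      rw [hz, hz1] at h
      nlinarith [norm_nonneg (initE (z : 𝔼 (m + 2)))]
    refine ⟨⟨initE z, by rwa [mem_sphere_zero_iff_norm]⟩, Subtype.ext ?_⟩
    change snocE (initE (z : 𝔼 (m + 2))) 0 = z
    conv_rhs => rw [← snocE_initE (z : 𝔼 (m + 2))]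
    simp only [mem_setOf_eq] at hz
    rw [hz]

/-! ### The unit cube and the closed unit ball -/

variable (m) in
/-- The unit cube `[0,1]ᵐ ⊆ ℝᵐ`. [folklore] -/
def cubeSet : Set (𝔼 m) := {v | ∀ i, v i ∈ Icc (0 : ℝ) 1}

/-- The standard parametrisation `Iᵐ → [0,1]ᵐ ⊆ ℝᵐ` of the cube by `Iᵐ = (Fin m → I)`.
[folklore] -/
def cubeMap (x : Fin m → I) : 𝔼 m := WithLp.toLp 2 (fun i => (x i : ℝ))

/-- Coordinates of `cubeMap x`. [folklore] -/
@[simp]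
theorem cubeMap_apply (x : Fin m → I) (i : Fin m) : cubeMap x i = x i := rfl

/-- `cubeMap` is continuous. [folklore] -/
theorem continuous_cubeMap : Continuous (cubeMap : (Fin m → I) → 𝔼 m) :=
  (PiLp.continuous_toLp 2 _).comp
    (continuous_pi fun i => continuous_subtype_val.comp (continuous_apply i))

/-- `cubeMap` is injective. [folklore] -/
theorem cubeMap_injective : Injective (cubeMap : (Fin m → I) → 𝔼 m) := by
  intro x x' h
  funext i
  exact Subtype.ext (by simpa using congrArg (fun v : 𝔼 m => v i) h)

/-- `cubeMap` parametrises exactly the unit cube. [folklore] -/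
theorem range_cubeMap : range (cubeMap : (Fin m → I) → 𝔼 m) = cubeSet m := by
  ext v
  constructor
  · rintro ⟨x, rfl⟩ i
    exact ⟨by simpa using (x i).2.1, by simpa using (x i).2.2⟩
  · intro hv
    exact ⟨fun i => ⟨v i, hv i⟩, by ext i; simp⟩

/-- The unit cube is compact. [folklore] -/
theorem isCompact_cubeSet : IsCompact (cubeSet m) := by
  rw [← range_cubeMap]
  exact isCompact_range continuous_cubeMap

/-- The unit cube is convex. [folklore] -/
theorem convex_cubeSet : Convex ℝ (cubeSet m) := by
  have h : cubeSet m = ⋂ i, (EuclideanSpace.proj i : 𝔼 m →L[ℝ] ℝ) ⁻¹' Icc (0 : ℝ) 1 := by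
    ext v
    simp [cubeSet]
  rw [h]
  exact convex_iInter fun i => (convex_Icc 0 1).linear_preimage _

/-- The centre `(½, …, ½)` of the unit cube. [folklore] -/
def cubeCentre : 𝔼 m := WithLp.toLp 2 (fun _ => (1 / 2 : ℝ))

/-- The ball of radius `½` about the centre lies in the unit cube. [folklore] -/
theorem ball_cubeCentre_subset : ball (cubeCentre : 𝔼 m) (1 / 2) ⊆ cubeSet m := by
  intro v hv i
  rw [mem_ball, dist_eq_norm] at hv
  have h1 : |(v - (cubeCentre : 𝔼 m)) i| < 1 / 2 :=
    lt_of_le_of_lt (by simpa using PiLp.norm_apply_le (v - (cubeCentre : 𝔼 m)) i) hv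
  have h2 : (v - (cubeCentre : 𝔼 m)) i = v i - 1 / 2 := by simp [cubeCentre]
  rw [h2, abs_lt] at h1
  constructor <;> linarith [h1.1, h1.2]

/-- The unit cube has nonempty interior. [folklore] -/
theorem interior_cubeSet_nonempty : (interior (cubeSet m)).Nonempty :=
  ⟨cubeCentre, interior_mono ball_cubeCentre_subset
    (by rw [isOpen_ball.interior_eq]; exact mem_ball_self (by norm_num))⟩

/-- Some homeomorphism of `ℝᵐ` carries the unit cube onto the closed unit ball: both are bounded
convex sets with nonempty interior (Mathlib's
`exists_homeomorph_image_interior_closure_frontier_eq_unitBall`, gauge rescaling). [folklore] -/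
theorem exists_homeomorph_image_cubeSet :
    ∃ e : 𝔼 m ≃ₜ 𝔼 m, e '' cubeSet m = closedBall 0 1 := by
  obtain ⟨e, -, h, -⟩ := exists_homeomorph_image_interior_closure_frontier_eq_unitBall
    (convex_cubeSet (m := m)) interior_cubeSet_nonempty (isCompact_cubeSet (m := m)).isBounded
  exact ⟨e, by rwa [isCompact_cubeSet.isClosed.closure_eq] at h⟩

/-- A homeomorphism of `ℝᵐ` carrying the unit cube onto the closed unit ball (Mathlib's gauge
rescaling, `exists_homeomorph_image_interior_closure_frontier_eq_unitBall`). [folklore] -/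
def cubeToBallHomeomorph : 𝔼 m ≃ₜ 𝔼 m := (exists_homeomorph_image_cubeSet (m := m)).choose

/-- `cubeToBallHomeomorph` carries the unit cube onto the closed unit ball. [folklore] -/
theorem image_cubeToBallHomeomorph :
    (cubeToBallHomeomorph : 𝔼 m ≃ₜ 𝔼 m) '' cubeSet m = closedBall 0 1 :=
  (exists_homeomorph_image_cubeSet (m := m)).choose_spec

/-- A continuous bijection `Iᵐ → closed unit ball of ℝᵐ`. [folklore] -/
def cubeToBall (x : Fin m → I) : 𝔼 m := cubeToBallHomeomorph (cubeMap x)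

/-- `cubeToBall` is continuous. [folklore] -/
theorem continuous_cubeToBall : Continuous (cubeToBall : (Fin m → I) → 𝔼 m) :=
  (cubeToBallHomeomorph (m := m)).continuous.comp continuous_cubeMap

/-- `cubeToBall` is injective. [folklore] -/
theorem cubeToBall_injective : Injective (cubeToBall : (Fin m → I) → 𝔼 m) :=
  (cubeToBallHomeomorph (m := m)).injective.comp cubeMap_injective

/-- `cubeToBall` maps `Iᵐ` onto the closed unit ball. [folklore] -/
theorem range_cubeToBall : range (cubeToBall : (Fin m → I) → 𝔼 m) = closedBall 0 1 := by
  rw [← image_cubeToBallHomeomorph, ← range_cubeMap, ← range_comp]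
  rfl

/-- `cubeToBall` takes values in the closed unit ball. [folklore] -/
theorem norm_cubeToBall_le (x : Fin m → I) : ‖cubeToBall x‖ ≤ 1 := by
  have h : cubeToBall x ∈ closedBall (0 : 𝔼 m) 1 := by
    rw [← range_cubeToBall]
    exact mem_range_self x
  rwa [mem_closedBall, dist_zero_right] at h

/-! ### Closed hemispheres as cubes -/

/-- For `ε = ±1` and `y` in the closed unit ball, the height `ε √(1 - ‖y‖²)`. [folklore] -/
def height (ε : ℝ) (y : 𝔼 m) : ℝ := ε * √(1 - ‖y‖ ^ 2)

/-- The height function is continuous. [folklore] -/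
theorem continuous_height (ε : ℝ) : Continuous (height ε : 𝔼 m → ℝ) :=
  continuous_const.mul ((continuous_const.sub (continuous_norm.pow 2)).sqrt)

/-- On the closed unit ball, `height ε y ^ 2 = 1 - ‖y‖²` for `ε = ±1`. [folklore] -/
theorem height_sq {ε : ℝ} (hε : ε ^ 2 = 1) {y : 𝔼 m} (hy : ‖y‖ ≤ 1) :
    height ε y ^ 2 = 1 - ‖y‖ ^ 2 := by
  have h0 : 0 ≤ 1 - ‖y‖ ^ 2 := by nlinarith [norm_nonneg y]
  rw [height, mul_pow, Real.sq_sqrt h0, hε, one_mul]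

/-- **The closed hemispheres of `𝕊ᵐ` are cubes**: for `ε = ±1`, the continuous injection
`Iᵐ → 𝕊ᵐ`, `x ↦ (y, ε √(1 - ‖y‖²))` with `y = cubeToBall x`, whose image is the closed
hemisphere `{z | 0 ≤ ε z_m}`. [folklore] -/
def hemisphere (ε : ℝ) (hε : ε ^ 2 = 1) (x : Fin m → I) : 𝕊 m :=
  ⟨snocE (cubeToBall x) (height ε (cubeToBall x)), by
    have h := norm_snocE_sq (cubeToBall x) (height ε (cubeToBall x))
    rw [height_sq hε (norm_cubeToBall_le x), add_sub_cancel] at h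
    rw [mem_sphere_zero_iff_norm]
    nlinarith [norm_nonneg (snocE (cubeToBall x) (height ε (cubeToBall x)))]⟩

/-- The hemisphere map on coordinates. [folklore] -/
@[simp]
theorem coe_hemisphere (ε : ℝ) (hε : ε ^ 2 = 1) (x : Fin m → I) :
    (hemisphere ε hε x : 𝔼 (m + 1)) = snocE (cubeToBall x) (height ε (cubeToBall x)) := rfl

/-- The hemisphere map is continuous. [folklore] -/
theorem continuous_hemisphere (ε : ℝ) (hε : ε ^ 2 = 1) :
    Continuous (hemisphere ε hε : (Fin m → I) → 𝕊 m) :=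
  Continuous.subtype_mk (continuous_snocE.comp
    (continuous_cubeToBall.prodMk ((continuous_height ε).comp continuous_cubeToBall))) _

/-- The hemisphere map is injective. [folklore] -/
theorem hemisphere_injective (ε : ℝ) (hε : ε ^ 2 = 1) :
    Injective (hemisphere ε hε : (Fin m → I) → 𝕊 m) := fun _ _ h =>
  cubeToBall_injective (snocE_injective_left (congrArg Subtype.val h))

/-- The image of the hemisphere map `hemisphere ε` is the closed hemisphere `{z ∈ 𝕊ᵐ | 0 ≤ ε z_m}`.
[folklore] -/
theorem range_hemisphere (ε : ℝ) (hε : ε ^ 2 = 1) :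
    range (hemisphere ε hε : (Fin m → I) → 𝕊 m) =
      {z : 𝕊 m | 0 ≤ ε * (z : 𝔼 (m + 1)) (Fin.last m)} := by
  have hε' : |ε| = 1 :=
    (pow_eq_one_iff_of_nonneg (abs_nonneg ε) two_ne_zero).mp (by rw [sq_abs]; exact hε)
  ext z
  constructor
  · rintro ⟨x, rfl⟩
    simp only [mem_setOf_eq, coe_hemisphere, snocE_apply_last, height, ← mul_assoc, ← sq, hε,
      one_mul]
    exact Real.sqrt_nonneg _
  · intro hz
    simp only [mem_setOf_eq] at hz
    have hz1 : ‖(z : 𝔼 (m + 1))‖ = 1 := norm_eq_of_mem_sphere z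
    have hsq := norm_sq_eq_norm_initE_sq_add (z : 𝔼 (m + 1))
    rw [hz1, one_pow] at hsq
    have hy : initE (z : 𝔼 (m + 1)) ∈ closedBall (0 : 𝔼 m) 1 := by
      rw [mem_closedBall, dist_zero_right]
      nlinarith [norm_nonneg (initE (z : 𝔼 (m + 1))), sq_nonneg ((z : 𝔼 (m + 1)) (Fin.last m))]
    rw [← range_cubeToBall] at hy
    obtain ⟨x, hx⟩ := hy
    refine ⟨x, Subtype.ext ?_⟩
    rw [coe_hemisphere, hx]
    conv_rhs => rw [← snocE_initE (z : 𝔼 (m + 1))]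
    congr 1
    have h1 : 1 - ‖initE (z : 𝔼 (m + 1))‖ ^ 2 = (z : 𝔼 (m + 1)) (Fin.last m) ^ 2 := by linarith
    rw [height, h1, Real.sqrt_sq_eq_abs]
    have h2 : |(z : 𝔼 (m + 1)) (Fin.last m)| = ε * (z : 𝔼 (m + 1)) (Fin.last m) := by
      rw [← abs_of_nonneg hz, abs_mul, hε', one_mul]
    rw [h2, ← mul_assoc, ← sq, hε, one_mul]

/-- The two closed hemispheres cover the sphere. [folklore] -/
theorem range_hemisphere_union_range_hemisphere :
    range (hemisphere 1 (by norm_num) : (Fin m → I) → 𝕊 m) ∪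
      range (hemisphere (-1) (by norm_num) : (Fin m → I) → 𝕊 m) = univ := by
  rw [range_hemisphere, range_hemisphere]
  refine eq_univ_of_forall fun z => ?_
  rcases le_total 0 ((z : 𝔼 (m + 1)) (Fin.last m)) with h | h
  · exact Or.inl (by simpa using h)
  · exact Or.inr (by simpa using h)

/-- The two closed hemispheres meet in the equator `{z | z_m = 0}`. [folklore] -/
theorem range_hemisphere_inter_range_hemisphere :
    range (hemisphere 1 (by norm_num) : (Fin m → I) → 𝕊 m) ∩
      range (hemisphere (-1) (by norm_num) : (Fin m → I) → 𝕊 m) =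
        {z : 𝕊 m | (z : 𝔼 (m + 1)) (Fin.last m) = 0} := by
  rw [range_hemisphere, range_hemisphere]
  ext z
  simp only [mem_inter_iff, mem_setOf_eq, one_mul, neg_mul, Left.nonneg_neg_iff]
  constructor
  · rintro ⟨h1, h2⟩
    exact le_antisymm h2 h1
  · intro h
    simp [h]

/-! ### Punctured spheres -/

section Punctured

variable {n : ℕ}

/-- **A punctured sphere is a Euclidean space**: `𝕊ⁿ ∖ {v} ≃ₜ ℝⁿ` by stereographic projection
from `v` (Mathlib's `stereographic'`). [folklore] -/
def sphereMinusPointHomeomorph (v : 𝕊 n) : ↥({v}ᶜ : Set (𝕊 n)) ≃ₜ 𝔼 n :=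
  haveI : Fact (Module.finrank ℝ (𝔼 (n + 1)) = n + 1) := ⟨finrank_euclideanSpace_fin⟩
  (Homeomorph.setCongr (stereographic'_source v).symm).trans <|
    ((stereographic' n v).toHomeomorphSourceTarget).trans <|
      (Homeomorph.setCongr (stereographic'_target v)).trans (Homeomorph.Set.univ _)

/-- `𝕊ⁿ ∖ {v, w}` as the punctured `𝕊ⁿ ∖ {v}`. [folklore] -/
def sphereMinusTwoPointsHomeomorphAux (v w : 𝕊 n) (hw : w ≠ v) :
    ↥(({v, w} : Set (𝕊 n))ᶜ) ≃ₜ {y : ↥({v}ᶜ : Set (𝕊 n)) // y ≠ ⟨w, hw⟩} where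
  toFun z := ⟨⟨z.1, fun h => z.2 (Or.inl h)⟩, fun h => z.2 (Or.inr (congrArg Subtype.val h))⟩
  invFun y := ⟨y.1.1, fun h => h.elim (fun h₁ => y.1.2 h₁) fun h₂ => y.2 (Subtype.ext h₂)⟩
  left_inv _ := rfl
  right_inv _ := rfl
  continuous_toFun := (continuous_subtype_val.subtype_mk _).subtype_mk _
  continuous_invFun := (continuous_subtype_val.comp continuous_subtype_val).subtype_mk _

/-- `𝕊ⁿ ∖ {v} ≃ₜ ℝⁿ` in the coordinate model `Literature.RVec n = (Fin n → ℝ)` of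
`PuncturedEuclidean.lean`. [folklore] -/
def sphereMinusPointCoords (v : 𝕊 n) : ↥({v}ᶜ : Set (𝕊 n)) ≃ₜ RVec n :=
  (sphereMinusPointHomeomorph v).trans (coords n).toHomeomorph

/-- `𝕊ⁿ ∖ {v, w} ≃ₜ ℝⁿ ∖ {c}`, `c` the image of `w` under stereographic projection from `v`.
[folklore] -/
def sphereMinusTwoPointsHomeomorphAux' (v w : 𝕊 n) (hw : w ≠ v) :
    {y : ↥({v}ᶜ : Set (𝕊 n)) // y ≠ ⟨w, hw⟩} ≃ₜ
      ↥({sphereMinusPointCoords v ⟨w, hw⟩}ᶜ : Set (RVec n)) :=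
  (sphereMinusPointCoords v).subtype fun y => by
    rw [mem_compl_singleton_iff]
    exact (sphereMinusPointCoords v).injective.ne_iff.symm

/-- **A twice punctured sphere is a punctured Euclidean space**: `𝕊ⁿ ∖ {v, w} ≃ₜ ℝⁿ ∖ {0}`
(stereographic projection from `v`, then a translation), in the coordinate model `Literature.punctured n`
of `PuncturedEuclidean.lean`. [folklore] -/
def sphereMinusTwoPointsHomeomorph (v w : 𝕊 n) (hw : w ≠ v) :
    ↥(({v, w} : Set (𝕊 n))ᶜ) ≃ₜ ↥(punctured n) :=
  (sphereMinusTwoPointsHomeomorphAux v w hw).trans <|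
    (sphereMinusTwoPointsHomeomorphAux' v w hw).trans
      (complSingletonHomeomorph (sphereMinusPointCoords v ⟨w, hw⟩))

/-! ### The `0`-sphere -/

/-- The two points `±1` of `𝕊⁰ ⊆ ℝ¹` (`ε = ±1`). [folklore] -/
def pole (ε : ℝ) (hε : ε ^ 2 = 1) : 𝕊 0 :=
  ⟨EuclideanSpace.single 0 ε, by
    have h : |ε| = 1 := (pow_eq_one_iff_of_nonneg (abs_nonneg ε) two_ne_zero).mp
      (by rw [sq_abs]; exact hε)
    rw [mem_sphere_zero_iff_norm, PiLp.norm_single, Real.norm_eq_abs, h]⟩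

/-- Coordinates of the poles of `𝕊⁰`. [folklore] -/
@[simp]
theorem coe_pole (ε : ℝ) (hε : ε ^ 2 = 1) : (pole ε hε : 𝔼 1) = EuclideanSpace.single 0 ε := rfl

/-- A point of `𝕊⁰` is the pole `ε` iff its coordinate is `ε`. [folklore] -/
theorem eq_pole_iff {ε : ℝ} (hε : ε ^ 2 = 1) (z : 𝕊 0) : z = pole ε hε ↔ (z : 𝔼 1) 0 = ε := by
  constructor
  · rintro rfl
    simp
  · intro h
    apply Subtype.ext
    ext i
    fin_cases i
    simp [h]

/-- `𝕊⁰ = {1, -1}`. [folklore] -/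
theorem eq_pole_one_or (z : 𝕊 0) :
    z = pole 1 (by norm_num) ∨ z = pole (-1) (by norm_num) := by
  rw [eq_pole_iff, eq_pole_iff]
  have hz := norm_eq_of_mem_sphere z
  have h2 : ‖(z : 𝔼 1)‖ ^ 2 = (z : 𝔼 1) 0 ^ 2 := by
    rw [EuclideanSpace.real_norm_sq_eq, Fin.sum_univ_one]
  rw [hz, one_pow] at h2
  have h3 : ((z : 𝔼 1) 0 - 1) * ((z : 𝔼 1) 0 + 1) = 0 := by nlinarith
  rcases mul_eq_zero.mp h3 with h | h
  · exact Or.inl (by linarith)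
  · exact Or.inr (by linarith)

/-- The two poles of `𝕊⁰` are distinct. [folklore] -/
theorem pole_one_ne_pole_neg_one : pole 1 (by norm_num) ≠ pole (-1) (by norm_num) := by
  intro h
  have h1 := (eq_pole_iff (by norm_num) (pole 1 (by norm_num))).mp h
  simp at h1
  norm_num at h1

/-- A map out of `𝕊⁰` takes exactly two values. [folklore] -/
theorem range_eq_pair_of_sphere_zero {α : Type*} (f : 𝕊 0 → α) :
    range f = {f (pole 1 (by norm_num)), f (pole (-1) (by norm_num))} := by
  ext a
  constructor
  · rintro ⟨z, rfl⟩
    rcases eq_pole_one_or z with rfl | rfl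
    · exact Or.inl rfl
    · exact Or.inr rfl
  · rintro (rfl | rfl)
    · exact ⟨_, rfl⟩
    · exact ⟨_, rfl⟩

end Punctured


end Geometry

section MayerVietoris

variable (R : Type v) [CommRing R] (M : Type v) [AddCommGroup M] [Module R M]
variable {X : Type u} [TopologicalSpace X]


/-- An element of a binary biproduct of modules vanishes if both its projections do. [folklore] -/
theorem biprod_ext_elem {P Q : ModuleCat.{w} R} (x : ↑(P ⊞ Q))
    (h₁ : (biprod.fst : P ⊞ Q ⟶ P) x = 0) (h₂ : (biprod.snd : P ⊞ Q ⟶ Q) x = 0) : x = 0 := by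
  have h : (ModuleCat.biprodIsoProd P Q).hom x = 0 := by
    refine Prod.ext ?_ ?_
    · have := ModuleCat.biprodIsoProd_inv_comp_fst_apply P Q ((ModuleCat.biprodIsoProd P Q).hom x)
      rw [Iso.hom_inv_id_apply] at this
      rw [← this, h₁]
      rfl
    · have := ModuleCat.biprodIsoProd_inv_comp_snd_apply P Q ((ModuleCat.biprodIsoProd P Q).hom x)
      rw [Iso.hom_inv_id_apply] at this
      rw [← this, h₂]
      rfl
  have h' := congrArg (ModuleCat.biprodIsoProd P Q).inv h
  rwa [Iso.hom_inv_id_apply, map_zero] at h'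

/-- For `T ⊆ S ⊆ X`, the subspace `S ↓∩ T` of the subspace `S` is homeomorphic to `T` (this is
`Literature.preimageValHomeomorph S T : S ↓∩ T ≃ₜ ↥(S ∩ T)` of `ExcisionMayerVietoris.lean` followed by
`Homeomorph.setCongr (inter_eq_right.2 h)`; spelled out so that both directions are definitionally
the obvious maps, which the `rfl` proofs below use). [folklore] -/
def preimageValHomeomorphOfSubset {S T : Set X} (h : T ⊆ S) :
    ↥(Subtype.val ⁻¹' T : Set S) ≃ₜ T where
  toFun x := ⟨x.1.1, x.2⟩
  invFun y := ⟨⟨y.1, h y.2⟩, y.2⟩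
  left_inv _ := rfl
  right_inv _ := rfl
  continuous_toFun := by fun_prop
  continuous_invFun := by fun_prop

variable {U₁ U₂ : Set X}

/-- The traces of the open sets `U₁`, `U₂` on `U₁ ∪ U₂` are open pieces whose interiors cover it.
[folklore] -/
theorem interior_union_interior_eq_univ (hU₁ : IsOpen U₁) (hU₂ : IsOpen U₂) :
    interior (Subtype.val ⁻¹' U₁ : Set ↥(U₁ ∪ U₂)) ∪ interior (Subtype.val ⁻¹' U₂) = univ := by
  rw [(hU₁.preimage continuous_subtype_val).interior_eq,
    (hU₂.preimage continuous_subtype_val).interior_eq]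
  ext x
  simp only [mem_union, mem_preimage, mem_univ, iff_true]
  exact x.2

/-- **Mayer–Vietoris, vanishing criterion for an intersection.** Let `U₁`, `U₂` be open subsets of
`X`. If `Hᵢ(U₁; M) = 0`, `Hᵢ(U₂; M) = 0` and `Hᵢ₊₁(U₁ ∪ U₂; M) = 0` then `Hᵢ(U₁ ∩ U₂; M) = 0`: in
the Mayer–Vietoris sequence `Hᵢ₊₁(U₁ ∪ U₂) ⟶ Hᵢ(U₁ ∩ U₂) ⟶ Hᵢ(U₁) ⊞ Hᵢ(U₂)` of the open cover of
`U₁ ∪ U₂` (Hatcher, *Algebraic Topology*, §2.2, p. 149) both ends vanish. Relies on the named facts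
`relativeSingularHomology.isIso_map_of_interior_union_interior` (excision, for the space
`U₁ ∪ U₂`) and `mayerVietoris.exact₃`, taken as hypotheses. [cite: HatcherAT2002, §2.2 p. 149] -/
theorem isZero_inter_of_isZero_union (hU₁ : IsOpen U₁) (hU₂ : IsOpen U₂)
    (hexc : relativeSingularHomology.isIso_map_of_interior_union_interior R M ↥(U₁ ∪ U₂))
    (h₃ : ∀ A B : Set ↥(U₁ ∪ U₂), mayerVietoris.exact₃ R M A B) (i : ℕ)
    (h₁ : IsZero (singularHomology R M U₁ i)) (h₂ : IsZero (singularHomology R M U₂ i))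
    (h : IsZero (singularHomology R M ↥(U₁ ∪ U₂) (i + 1))) :
    IsZero (singularHomology R M ↥(U₁ ∩ U₂) i) := by
  have hAB := interior_union_interior_eq_univ hU₁ hU₂
  have hex := h₃ (Subtype.val ⁻¹' U₁) (Subtype.val ⁻¹' U₂) hexc hAB i
  haveI hmono : Mono (mayerVietoris.φ R M (Subtype.val ⁻¹' U₁ : Set ↥(U₁ ∪ U₂))
      (Subtype.val ⁻¹' U₂) i) := hex.mono_g (h.eq_of_src _ _)
  have hA : IsZero (singularHomology R M ↥(Subtype.val ⁻¹' U₁ : Set ↥(U₁ ∪ U₂)) i) :=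
    h₁.of_iso (singularHomology.mapIso R M (preimageValHomeomorphOfSubset subset_union_left) i)
  have hB : IsZero (singularHomology R M ↥(Subtype.val ⁻¹' U₂ : Set ↥(U₁ ∪ U₂)) i) :=
    h₂.of_iso (singularHomology.mapIso R M (preimageValHomeomorphOfSubset subset_union_right) i)
  have h0 := IsZero.of_mono (mayerVietoris.φ R M (Subtype.val ⁻¹' U₁ : Set ↥(U₁ ∪ U₂))
      (Subtype.val ⁻¹' U₂) i) ((biprod_isZero_iff _ _).2 ⟨hA, hB⟩)
  exact h0.of_iso (singularHomology.mapIso R M (preimageValHomeomorphOfSubset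
    (S := U₁ ∪ U₂) (T := U₁ ∩ U₂) (inter_subset_left.trans subset_union_left)).symm i)

/-- **Mayer–Vietoris, injectivity criterion.** Let `U₁`, `U₂` be open subsets of `X` with
`Hᵢ₊₁(U₁ ∪ U₂; M) = 0`. Then a class `α ∈ Hᵢ(U₁ ∩ U₂; M)` which dies in both `Hᵢ(U₁; M)` and
`Hᵢ(U₂; M)` is zero: the map `Hᵢ(U₁ ∩ U₂) ⟶ Hᵢ(U₁) ⊞ Hᵢ(U₂)` of the Mayer–Vietoris sequence of the
open cover of `U₁ ∪ U₂` is injective (Hatcher, *Algebraic Topology*, §2.2, p. 149). Relies on the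
named facts `relativeSingularHomology.isIso_map_of_interior_union_interior` (excision, for
`U₁ ∪ U₂`) and `mayerVietoris.exact₃`, taken as hypotheses. [cite: HatcherAT2002, §2.2 p. 149] -/
theorem eq_zero_of_map_eq_zero_of_isZero_union (hU₁ : IsOpen U₁) (hU₂ : IsOpen U₂)
    (hexc : relativeSingularHomology.isIso_map_of_interior_union_interior R M ↥(U₁ ∪ U₂))
    (h₃ : ∀ A B : Set ↥(U₁ ∪ U₂), mayerVietoris.exact₃ R M A B) (i : ℕ)
    (h : IsZero (singularHomology R M ↥(U₁ ∪ U₂) (i + 1)))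
    (α : singularHomology R M ↥(U₁ ∩ U₂) i)
    (hα₁ : singularHomology.map R M (subsetInclusion (inter_subset_left : U₁ ∩ U₂ ⊆ U₁)) i α = 0)
    (hα₂ : singularHomology.map R M (subsetInclusion (inter_subset_right : U₁ ∩ U₂ ⊆ U₂)) i α = 0) :
    α = 0 := by
  have hAB := interior_union_interior_eq_univ hU₁ hU₂
  have hex := h₃ (Subtype.val ⁻¹' U₁) (Subtype.val ⁻¹' U₂) hexc hAB i
  haveI hmono : Mono (mayerVietoris.φ R M (Subtype.val ⁻¹' U₁ : Set ↥(U₁ ∪ U₂))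
      (Subtype.val ⁻¹' U₂) i) := hex.mono_g (h.eq_of_src _ _)
  -- the identifications of the pieces of `U₁ ∪ U₂` with `U₁`, `U₂`, `U₁ ∩ U₂`
  let A : Set ↥(U₁ ∪ U₂) := Subtype.val ⁻¹' U₁
  let B : Set ↥(U₁ ∪ U₂) := Subtype.val ⁻¹' U₂
  let e : ↥(A ∩ B) ≃ₜ ↥(U₁ ∩ U₂) :=
    preimageValHomeomorphOfSubset (S := U₁ ∪ U₂) (T := U₁ ∩ U₂)
      (inter_subset_left.trans subset_union_left)
  let e₁ : ↥A ≃ₜ ↥U₁ := preimageValHomeomorphOfSubset subset_union_left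
  let e₂ : ↥B ≃ₜ ↥U₂ := preimageValHomeomorphOfSubset subset_union_right
  let f : C(↥(U₁ ∩ U₂), ↥(A ∩ B)) := e.symm
  let g : C(↥(A ∩ B), ↥(U₁ ∩ U₂)) := e
  let f₁ : C(↥U₁, ↥A) := e₁.symm
  let f₂ : C(↥U₂, ↥B) := e₂.symm
  have he₁ : (subsetInclusion (inter_subset_left : A ∩ B ⊆ A)).comp f =
      f₁.comp (subsetInclusion (inter_subset_left : U₁ ∩ U₂ ⊆ U₁)) := by
    ext x
    rfl
  have he₂ : (subsetInclusion (inter_subset_right : A ∩ B ⊆ B)).comp f =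
      f₂.comp (subsetInclusion (inter_subset_right : U₁ ∩ U₂ ⊆ U₂)) := by
    ext x
    rfl
  have hgf : g.comp f = ContinuousMap.id _ := by
    ext x
    rfl
  set β := singularHomology.map R M f i α with hβ
  have hb₁ : singularHomology.map R M (subsetInclusion (inter_subset_left : A ∩ B ⊆ A)) i β
      = 0 := by
    rw [hβ, ← ModuleCat.comp_apply, ← singularHomology.map_comp, he₁, singularHomology.map_comp,
      ModuleCat.comp_apply, hα₁, map_zero]
  have hb₂ : singularHomology.map R M (subsetInclusion (inter_subset_right : A ∩ B ⊆ B)) i β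
      = 0 := by
    rw [hβ, ← ModuleCat.comp_apply, ← singularHomology.map_comp, he₂, singularHomology.map_comp,
      ModuleCat.comp_apply, hα₂, map_zero]
  have hφ : mayerVietoris.φ R M A B i β = 0 := by
    apply biprod_ext_elem
    · rw [← ModuleCat.comp_apply, mayerVietoris.φ, biprod.lift_fst, hb₁]
    · rw [← ModuleCat.comp_apply, mayerVietoris.φ, biprod.lift_snd]
      simp [hb₂]
  have hβ0 : β = 0 :=
    (ModuleCat.mono_iff_injective _).mp hmono (by rw [hφ, map_zero])
  have hαβ : α = singularHomology.map R M g i β := by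
    rw [hβ, ← ModuleCat.comp_apply, ← singularHomology.map_comp, hgf, singularHomology.map_id,
      ModuleCat.id_apply]
  rw [hαβ, hβ0, map_zero]


/-! ### The two Mayer–Vietoris criteria, as properties of an ambient space -/

variable (X) in
/-- **The Mayer–Vietoris vanishing criterion for intersections**, as a property of the ambient
space `X`: for all open `U₁`, `U₂ ⊆ X` and all `i`, if `Hᵢ(U₁; M) = 0`, `Hᵢ(U₂; M) = 0` and
`Hᵢ₊₁(U₁ ∪ U₂; M) = 0` then `Hᵢ(U₁ ∩ U₂; M) = 0` (Hatcher, *Algebraic Topology*, §2.2, p. 149: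
both ends of `Hᵢ₊₁(U₁ ∪ U₂) ⟶ Hᵢ(U₁ ∩ U₂) ⟶ Hᵢ(U₁) ⊞ Hᵢ(U₂)` vanish). It holds granted excision and
Mayer–Vietoris exactness (`mvInterVanishing_of_mayerVietoris`); the theorems below take it as a
hypothesis, so that any proof of the Mayer–Vietoris sequence can be plugged in.
[cite: HatcherAT2002, §2.2 p. 149] -/
def MVInterVanishing : Prop :=
  ∀ ⦃U₁ U₂ : Set X⦄, IsOpen U₁ → IsOpen U₂ → ∀ (i : ℕ), IsZero (singularHomology R M U₁ i) →
    IsZero (singularHomology R M U₂ i) → IsZero (singularHomology R M ↥(U₁ ∪ U₂) (i + 1)) →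
      IsZero (singularHomology R M ↥(U₁ ∩ U₂) i)

variable (X) in
/-- **The Mayer–Vietoris injectivity criterion**, as a property of the ambient space `X`: for all
open `U₁`, `U₂ ⊆ X` and all `i`, if `Hᵢ₊₁(U₁ ∪ U₂; M) = 0` then a class of `Hᵢ(U₁ ∩ U₂; M)` dying
in both `Hᵢ(U₁; M)` and `Hᵢ(U₂; M)` is zero (Hatcher, *Algebraic Topology*, §2.2, p. 149:
`Hᵢ(U₁ ∩ U₂) ⟶ Hᵢ(U₁) ⊞ Hᵢ(U₂)` is injective). It holds granted excision and Mayer–Vietoris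
exactness (`mvInterInjectivity_of_mayerVietoris`). [cite: HatcherAT2002, §2.2 p. 149] -/
def MVInterInjectivity : Prop :=
  ∀ ⦃U₁ U₂ : Set X⦄, IsOpen U₁ → IsOpen U₂ → ∀ (i : ℕ),
    IsZero (singularHomology R M ↥(U₁ ∪ U₂) (i + 1)) → ∀ α : singularHomology R M ↥(U₁ ∩ U₂) i,
      singularHomology.map R M (subsetInclusion (inter_subset_left : U₁ ∩ U₂ ⊆ U₁)) i α = 0 →
      singularHomology.map R M (subsetInclusion (inter_subset_right : U₁ ∩ U₂ ⊆ U₂)) i α = 0 →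
        α = 0

/-- The vanishing criterion from excision and Mayer–Vietoris exactness (named facts of
`ExcisionMayerVietoris.lean`, for all spaces of the universe of `X`).
[cite: HatcherAT2002, §2.2 p. 149] -/
theorem mvInterVanishing_of_mayerVietoris
    (hexc : ∀ (T : Type u) [TopologicalSpace T],
      relativeSingularHomology.isIso_map_of_interior_union_interior R M T)
    (h₃ : ∀ (T : Type u) [TopologicalSpace T] (U V : Set T), mayerVietoris.exact₃ R M U V) :
    MVInterVanishing R M X :=
  fun _ _ hU₁ hU₂ i h₁ h₂ h => isZero_inter_of_isZero_union R M hU₁ hU₂ (hexc _) (h₃ _) i h₁ h₂ h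

/-- The injectivity criterion from excision and Mayer–Vietoris exactness (named facts of
`ExcisionMayerVietoris.lean`, for all spaces of the universe of `X`).
[cite: HatcherAT2002, §2.2 p. 149] -/
theorem mvInterInjectivity_of_mayerVietoris
    (hexc : ∀ (T : Type u) [TopologicalSpace T],
      relativeSingularHomology.isIso_map_of_interior_union_interior R M T)
    (h₃ : ∀ (T : Type u) [TopologicalSpace T] (U V : Set T), mayerVietoris.exact₃ R M U V) :
    MVInterInjectivity R M X :=
  fun _ _ hU₁ hU₂ i h α h₁ h₂ =>
    eq_zero_of_map_eq_zero_of_isZero_union R M hU₁ hU₂ (hexc _) (h₃ _) i h α h₁ h₂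

variable {R M} in
/-- The vanishing criterion with the union and intersection named. [folklore] -/
theorem MVInterVanishing.of_eq (hV : MVInterVanishing R M X) (hU₁ : IsOpen U₁) (hU₂ : IsOpen U₂)
    {W Y : Set X} (hW : U₁ ∩ U₂ = W) (hY : U₁ ∪ U₂ = Y) (i : ℕ)
    (h₁ : IsZero (singularHomology R M U₁ i)) (h₂ : IsZero (singularHomology R M U₂ i))
    (h : IsZero (singularHomology R M ↥Y (i + 1))) :
    IsZero (singularHomology R M ↥W i) := by
  subst hW hY
  exact hV hU₁ hU₂ i h₁ h₂ h

variable {R M} in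
/-- The injectivity criterion implies the vanishing criterion: if `Hᵢ(U₁) = Hᵢ(U₂) = 0` every
class of `Hᵢ(U₁ ∩ U₂)` dies in both, hence vanishes. [folklore] -/
theorem MVInterInjectivity.mvInterVanishing (hI : MVInterInjectivity R M X) :
    MVInterVanishing R M X := by
  intro U₁ U₂ hU₁ hU₂ i h₁ h₂ h
  rw [ModuleCat.isZero_iff_subsingleton]
  haveI := ModuleCat.subsingleton_of_isZero h₁
  haveI := ModuleCat.subsingleton_of_isZero h₂
  exact ⟨fun α β => by
    rw [hI hU₁ hU₂ i h α (Subsingleton.elim _ _) (Subsingleton.elim _ _),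
      hI hU₁ hU₂ i h β (Subsingleton.elim _ _) (Subsingleton.elim _ _)]⟩

end MayerVietoris

section Bisection


/-- Nested bisection of `[0, 1]` steered by a predicate `P a c` ("go left to `[a, c]`"):
`bisect P 0 = (0, 1)` and `bisect P (m + 1)` is the left or right half of `bisect P m`.
[folklore] -/
def bisect (P : ℝ → ℝ → Prop) : ℕ → ℝ × ℝ
  | 0 => (0, 1)
  | m + 1 =>
    open Classical in
    if P (bisect P m).1 (((bisect P m).1 + (bisect P m).2) / 2) then
      ((bisect P m).1, ((bisect P m).1 + (bisect P m).2) / 2)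
    else (((bisect P m).1 + (bisect P m).2) / 2, (bisect P m).2)

variable (P : ℝ → ℝ → Prop)

/-- The bisection starts at `[0, 1]`. [folklore] -/
theorem bisect_zero : bisect P 0 = (0, 1) := rfl

/-- Each step of the bisection passes to the left or to the right half. [folklore] -/
theorem bisect_succ (m : ℕ) :
    bisect P (m + 1) = ((bisect P m).1, ((bisect P m).1 + (bisect P m).2) / 2) ∨
      bisect P (m + 1) = (((bisect P m).1 + (bisect P m).2) / 2, (bisect P m).2) := by
  classical
  simp only [bisect]
  split_ifs
  · exact Or.inl rfl
  · exact Or.inr rfl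

/-- The `m`-th interval of the bisection has length `2⁻ᵐ`. [folklore] -/
theorem bisect_snd_sub_fst (m : ℕ) : (bisect P m).2 - (bisect P m).1 = (1 / 2 : ℝ) ^ m := by
  induction m with
  | zero => simp [bisect_zero]
  | succ m ih =>
    rcases bisect_succ P m with h | h <;> rw [h, pow_succ] <;> linarith

/-- The intervals of the bisection are genuine intervals. [folklore] -/
theorem bisect_fst_le_snd (m : ℕ) : (bisect P m).1 ≤ (bisect P m).2 := by
  have h := bisect_snd_sub_fst P m
  have : (0 : ℝ) ≤ (1 / 2) ^ m := by positivity
  linarith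

/-- Left endpoints increase along the bisection. [folklore] -/
theorem bisect_fst_mono : Monotone fun m => (bisect P m).1 := by
  refine monotone_nat_of_le_succ fun m => ?_
  have := bisect_fst_le_snd P m
  rcases bisect_succ P m with h | h
  · rw [h]
  · rw [h]
    dsimp only
    linarith

/-- Right endpoints decrease along the bisection. [folklore] -/
theorem bisect_snd_anti : Antitone fun m => (bisect P m).2 := by
  refine antitone_nat_of_succ_le fun m => ?_
  have := bisect_fst_le_snd P m
  rcases bisect_succ P m with h | h
  · rw [h]
    dsimp only
    linarith
  · rw [h]

/-- Left endpoints are `≥ 0`. [folklore] -/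
theorem bisect_fst_nonneg (m : ℕ) : 0 ≤ (bisect P m).1 := by
  simpa [bisect_zero] using bisect_fst_mono P (Nat.zero_le m)

/-- Right endpoints are `≤ 1`. [folklore] -/
theorem bisect_snd_le_one (m : ℕ) : (bisect P m).2 ≤ 1 := by
  simpa [bisect_zero] using bisect_snd_anti P (Nat.zero_le m)

/-- Every left endpoint is below every right endpoint. [folklore] -/
theorem bisect_fst_le_snd' (m k : ℕ) : (bisect P m).1 ≤ (bisect P k).2 := by
  rcases le_total m k with h | h
  · exact (bisect_fst_mono P h).trans (bisect_fst_le_snd P k)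
  · exact (bisect_fst_le_snd P m).trans (bisect_snd_anti P h)

/-- The intervals of the bisection are nested. [folklore] -/
theorem Icc_bisect_anti : Antitone fun m => Icc (bisect P m).1 (bisect P m).2 :=
  fun _ _ h => Icc_subset_Icc (bisect_fst_mono P h) (bisect_snd_anti P h)

/-- The common point of the nested intervals. [folklore] -/
def bisectLim : ℝ := ⨆ m, (bisect P m).1

/-- Left endpoints are bounded above. [folklore] -/
theorem bddAbove_bisect_fst : BddAbove (range fun m => (bisect P m).1) :=
  ⟨1, by rintro _ ⟨m, rfl⟩; exact (bisect_fst_le_snd P m).trans (bisect_snd_le_one P m)⟩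

/-- The limit point lies to the right of all left endpoints. [folklore] -/
theorem bisect_fst_le_lim (m : ℕ) : (bisect P m).1 ≤ bisectLim P :=
  le_ciSup (bddAbove_bisect_fst P) m

/-- The limit point lies to the left of all right endpoints. [folklore] -/
theorem lim_le_bisect_snd (m : ℕ) : bisectLim P ≤ (bisect P m).2 :=
  ciSup_le fun k => bisect_fst_le_snd' P k m

/-- The limit point lies in every interval of the bisection. [folklore] -/
theorem bisectLim_mem (m : ℕ) : bisectLim P ∈ Icc (bisect P m).1 (bisect P m).2 :=
  ⟨bisect_fst_le_lim P m, lim_le_bisect_snd P m⟩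

/-- The limit point lies in `[0, 1]`. [folklore] -/
theorem bisectLim_mem_unitInterval : bisectLim P ∈ Icc (0 : ℝ) 1 := by
  simpa [bisect_zero] using bisectLim_mem P 0

/-- **Nested intervals**: the intervals of the bisection shrink to the limit point. [folklore] -/
theorem iInter_Icc_bisect : ⋂ m, Icc (bisect P m).1 (bisect P m).2 = {bisectLim P} := by
  refine Subset.antisymm ?_ (fun s hs => mem_iInter.2 fun m => by
    rw [mem_singleton_iff.1 hs]; exact bisectLim_mem P m)
  intro s hs
  rw [mem_iInter] at hs
  by_contra hst
  have hpos : 0 < |s - bisectLim P| := abs_pos.2 (sub_ne_zero.2 hst)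
  obtain ⟨m, hm⟩ := exists_pow_lt_of_lt_one hpos (by norm_num : (1 / 2 : ℝ) < 1)
  obtain ⟨h1a, h1b⟩ := hs m
  obtain ⟨h2a, h2b⟩ := bisectLim_mem P m
  have h3 := bisect_snd_sub_fst P m
  have h4 : |s - bisectLim P| ≤ (bisect P m).2 - (bisect P m).1 := by
    rw [abs_le]
    constructor <;> linarith
  linarith

/-- The invariant: if `Q 0 1` and `Q` passes to one of the two halves, then `Q` holds along the
bisection steered by `Q` itself. [folklore] -/
theorem bisect_invariant (Q : ℝ → ℝ → Prop) (h0 : Q 0 1)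
    (hstep : ∀ a b, 0 ≤ a → b ≤ 1 → a ≤ b → Q a b → Q a ((a + b) / 2) ∨ Q ((a + b) / 2) b)
    (m : ℕ) : Q (bisect Q m).1 (bisect Q m).2 := by
  induction m with
  | zero => exact h0
  | succ m ih =>
    classical
    have hs := hstep _ _ (bisect_fst_nonneg Q m) (bisect_snd_le_one Q m) (bisect_fst_le_snd Q m) ih
    simp only [bisect]
    split_ifs with hl
    · exact hl
    · exact hs.resolve_left hl


end Bisection

section Slab

variable (R : Type v) [CommRing R] (M : Type v) [AddCommGroup M] [Module R M]
variable {X : Type u} [TopologicalSpace X]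

variable {R M}

/-- Restriction of homology classes to a smaller open set commutes: the inclusions compose.
[folklore] -/
theorem map_subsetInclusion_comp {A B C : Set X} (hAB : A ⊆ B) (hBC : B ⊆ C) (i : ℕ) :
    singularHomology.map R M (subsetInclusion hAB) i ≫
        singularHomology.map R M (subsetInclusion hBC) i =
      singularHomology.map R M (subsetInclusion (hAB.trans hBC)) i := by
  rw [← singularHomology.map_comp]
  rfl

/-- The inclusion of a set into an equal set induces an injective map (an isomorphism) on
homology. [folklore] -/
theorem map_subsetInclusion_injective_of_eq {A B : Set X} (hAB : A = B) (i : ℕ) :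
    Injective (singularHomology.map R M (subsetInclusion hAB.le) i) := by
  subst hAB
  have h : subsetInclusion (le_refl A) = ContinuousMap.id ↥A := by
    ext x
    rfl
  rw [h, singularHomology.map_id]
  exact fun x y hxy => hxy

variable {B : Type w} [TopologicalSpace B] (h : C(B × I, X))

/-- The complement `X ∖ h(B × J)` of the image of the part of `B × I` lying over `J ⊆ ℝ`.
[folklore] -/
def slabCompl (J : Set ℝ) : Set X := (h '' {p | (p.2 : ℝ) ∈ J})ᶜ

/-- `X ∖ h(B × J)` decreases as `J` increases. [folklore] -/
theorem slabCompl_anti {J J' : Set ℝ} (hJ : J ⊆ J') : slabCompl h J' ⊆ slabCompl h J :=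
  compl_subset_compl.2 (image_mono fun _ hp => hJ hp)

/-- `(X ∖ h(B × J₁)) ∩ (X ∖ h(B × J₂)) = X ∖ h(B × (J₁ ∪ J₂))`. [folklore] -/
theorem slabCompl_inter (J₁ J₂ : Set ℝ) :
    slabCompl h J₁ ∩ slabCompl h J₂ = slabCompl h (J₁ ∪ J₂) := by
  rw [slabCompl, slabCompl, slabCompl, ← compl_union, ← image_union]
  rfl

/-- `(X ∖ h(B × J₁)) ∪ (X ∖ h(B × J₂)) = X ∖ h(B × (J₁ ∩ J₂))` for injective `h`. [folklore] -/
theorem slabCompl_union (hinj : Injective h) (J₁ J₂ : Set ℝ) :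
    slabCompl h J₁ ∪ slabCompl h J₂ = slabCompl h (J₁ ∩ J₂) := by
  rw [slabCompl, slabCompl, slabCompl, ← compl_inter, ← image_inter hinj]
  rfl

/-- `⋃ₘ (X ∖ h(B × Jₘ)) = X ∖ h(B × ⋂ₘ Jₘ)` for injective `h`. [folklore] -/
theorem iUnion_slabCompl (hinj : Injective h) (J : ℕ → Set ℝ) :
    ⋃ m, slabCompl h (J m) = slabCompl h (⋂ m, J m) := by
  simp only [slabCompl]
  rw [← compl_iInter, ← (hinj.injOn).image_iInter_eq]
  congr 2
  ext p
  simp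

/-- `X ∖ h(B × I)` is the complement of the image of `h`. [folklore] -/
theorem slabCompl_univ : slabCompl h univ = (range h)ᶜ := by
  simp [slabCompl]

/-- `X ∖ h(B × {t})` is the complement of the image of the slice `h(·, t)`. [folklore] -/
theorem slabCompl_singleton (t : I) :
    slabCompl h {(t : ℝ)} = (range fun b => h (b, t))ᶜ := by
  rw [slabCompl]
  congr 1
  ext x
  constructor
  · rintro ⟨⟨b, t'⟩, ht', rfl⟩
    have : t' = t := Subtype.ext ht'
    subst this
    exact ⟨b, rfl⟩
  · rintro ⟨b, rfl⟩
    exact ⟨(b, t), rfl, rfl⟩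

/-- `X ∖ h(B × I) ⊆ X ∖ h(B × J)`. [folklore] -/
theorem slabCompl_univ_subset (J : Set ℝ) : slabCompl h univ ⊆ slabCompl h J :=
  slabCompl_anti h (subset_univ J)

/-- `X ∖ h(B × J)` is open for `J` closed (`B` compact, `X` Hausdorff). [folklore] -/
theorem isOpen_slabCompl [T2Space X] [CompactSpace B] {J : Set ℝ} (hJ : IsClosed J) :
    IsOpen (slabCompl h J) := by
  refine (IsCompact.image ?_ h.continuous).isClosed.isOpen_compl
  exact (hJ.preimage (continuous_subtype_val.comp continuous_snd)).isCompact

/-- Restriction `Hᵢ(X ∖ h(B × I)) ⟶ Hᵢ(X ∖ h(B × J))`. [folklore] -/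
abbrev res (J : Set ℝ) (i : ℕ) :
    singularHomology R M ↥(slabCompl h univ) i ⟶ singularHomology R M ↥(slabCompl h J) i :=
  singularHomology.map R M (subsetInclusion (slabCompl_univ_subset h J)) i

/-- Restrictions compose. [folklore] -/
theorem res_comp_map {J J' : Set ℝ} (hJ : J ⊆ J') (i : ℕ) :
    res (R := R) (M := M) h J' i ≫
        singularHomology.map R M (subsetInclusion (slabCompl_anti h hJ)) i = res h J i :=
  map_subsetInclusion_comp _ _ i

variable [T2Space X] [CompactSpace B] (hI : MVInterInjectivity R M X)

include hI in
/-- **The bisection step.** If `Hᵢ₊₁(X ∖ h(B × {c})) = 0` for the midpoint `c` of `[a, b]`, a class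
of `Hᵢ(X ∖ h(B × I))` which survives in `Hᵢ(X ∖ h(B × [a, b]))` survives in one of the two halves
(Mayer–Vietoris for `X ∖ h(B × {c}) = (X ∖ h(B × [a, c])) ∪ (X ∖ h(B × [c, b]))`, whose
intersection is `X ∖ h(B × [a, b])`; Hatcher, *Algebraic Topology*, proof of Prop. 2B.1(a)).
[cite: HatcherAT2002, Prop. 2B.1 (proof)] -/
theorem res_ne_zero_step (hinj : Injective h) {i : ℕ}
    (hB : ∀ t : I, IsZero (singularHomology R M ↥(slabCompl h {(t : ℝ)}) (i + 1)))
    (α : singularHomology R M ↥(slabCompl h univ) i) (a b : ℝ) (ha : 0 ≤ a) (hb : b ≤ 1)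
    (hab : a ≤ b) (hα : res h (Icc a b) i α ≠ 0) :
    res h (Icc a ((a + b) / 2)) i α ≠ 0 ∨ res h (Icc ((a + b) / 2) b) i α ≠ 0 := by
  by_contra hcon
  simp only [not_or, not_not] at hcon
  obtain ⟨h1, h2⟩ := hcon
  set c := (a + b) / 2 with hc
  have hac : a ≤ c := by rw [hc]; linarith
  have hcb : c ≤ b := by rw [hc]; linarith
  let tc : I := ⟨c, by constructor <;> linarith⟩
  have hW : slabCompl h (Icc a b) = slabCompl h (Icc a c) ∩ slabCompl h (Icc c b) := by
    rw [slabCompl_inter, Icc_union_Icc_eq_Icc hac hcb]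
  have hY : slabCompl h (Icc a c) ∪ slabCompl h (Icc c b) = slabCompl h {(tc : ℝ)} := by
    rw [slabCompl_union h hinj, Icc_inter_Icc_eq_singleton hac hcb]
  have key := hI (isOpen_slabCompl h isClosed_Icc) (isOpen_slabCompl h isClosed_Icc) i
    (by rw [hY]; exact hB tc)
    (singularHomology.map R M (subsetInclusion hW.le) i (res h (Icc a b) i α)) ?_ ?_
  · exact hα (map_subsetInclusion_injective_of_eq hW i (by rw [key, map_zero]))
  · rw [← h1]
    change ((res h (Icc a b) i ≫ singularHomology.map R M (subsetInclusion hW.le) i) ≫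
      singularHomology.map R M (subsetInclusion inter_subset_left) i) α = _
    rw [map_subsetInclusion_comp, map_subsetInclusion_comp]
  · rw [← h2]
    change ((res h (Icc a b) i ≫ singularHomology.map R M (subsetInclusion hW.le) i) ≫
      singularHomology.map R M (subsetInclusion inter_subset_right) i) α = _
    rw [map_subsetInclusion_comp, map_subsetInclusion_comp]

include hI in
/-- **Complements of slabs: the inductive step of Hatcher's Prop. 2B.1(a).** Let `B` be compact,
`X` Hausdorff and `h : B × I → X` a continuous injection. If `Hⱼ(X ∖ h(B × {t})) = 0` for all
`t ∈ I` and all `j ≠ 0`, then `Hᵢ(X ∖ h(B × I)) = 0` for all `i ≠ 0`. Proof (Hatcher, *Algebraic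
Topology*, Prop. 2B.1(a)): a non-zero class survives, by repeated bisection (`res_ne_zero_step`),
in `Hᵢ(X ∖ h(B × Jₘ))` along nested intervals `Jₘ` shrinking to a point `t`; it dies in
`X ∖ h(B × {t}) = ⋃ₘ X ∖ h(B × Jₘ)`, hence, singular homology having compact supports
(`singularHomology.exists_map_eq_zero_of_iUnion`), already in some `X ∖ h(B × Jₘ)` — a
contradiction. [cite: HatcherAT2002, Prop. 2B.1(a)] -/
theorem isZero_slabCompl_univ (hinj : Injective h)
    (hB : ∀ (t : I) (j : ℕ), j ≠ 0 → IsZero (singularHomology R M ↥(slabCompl h {(t : ℝ)}) j))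
    {i : ℕ} (hi : i ≠ 0) : IsZero (singularHomology R M ↥(slabCompl h univ) i) := by
  rw [ModuleCat.isZero_iff_subsingleton]
  -- every class vanishes
  suffices main : ∀ α : singularHomology R M ↥(slabCompl h univ) i, α = 0 from
    ⟨fun x y => by rw [main x, main y]⟩
  intro α
  by_contra hα
  -- the bisection steered by the survival of `α`
  let Q : ℝ → ℝ → Prop := fun a b => res h (Icc a b) i α ≠ 0
  have hQ0 : Q 0 1 := by
    have heq : slabCompl h univ = slabCompl h (Icc 0 1) := by
      simp only [slabCompl]
      congr 2
      ext p
      simp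
    intro h0
    exact hα (map_subsetInclusion_injective_of_eq heq i (by rw [map_zero]; exact h0))
  have hstep : ∀ a b, 0 ≤ a → b ≤ 1 → a ≤ b → Q a b → Q a ((a + b) / 2) ∨ Q ((a + b) / 2) b :=
    fun a b ha hb hab hq =>
      res_ne_zero_step h hI hinj (fun t => hB t (i + 1) i.succ_ne_zero) α a b ha hb hab hq
  have hinv : ∀ m, Q (bisect Q m).1 (bisect Q m).2 := bisect_invariant Q hQ0 hstep
  -- the nested open sets `X ∖ h(B × Jₘ)` exhausting `X ∖ h(B × {t})`
  let W : ℕ → Set X := fun m => slabCompl h (Icc (bisect Q m).1 (bisect Q m).2)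
  have hWo : ∀ m, IsOpen (W m) := fun m => isOpen_slabCompl h isClosed_Icc
  have hWm : Monotone W := fun m k hmk => slabCompl_anti h (Icc_bisect_anti Q hmk)
  let t : I := ⟨bisectLim Q, bisectLim_mem_unitInterval Q⟩
  have hV : ⋃ m, W m = slabCompl h {(t : ℝ)} := by
    change ⋃ m, slabCompl h (Icc (bisect Q m).1 (bisect Q m).2) = _
    rw [iUnion_slabCompl h hinj, iInter_Icc_bisect]
  haveI := ModuleCat.subsingleton_of_isZero (hB t i hi)
  obtain ⟨m, hm⟩ := singularHomology.exists_map_eq_zero_of_iUnion W hWo hWm hV i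
    (res h (Icc (bisect Q 0).1 (bisect Q 0).2) i α) (Subsingleton.elim _ _)
  refine hinv m ?_
  rw [← res_comp_map h (Icc_bisect_anti Q (Nat.zero_le m)) i, ModuleCat.comp_apply]
  exact hm

end Slab



section Cubes

variable {R : Type v} [CommRing R] {M : Type v} [AddCommGroup M] [Module R M]
variable {X : Type u} [TopologicalSpace X] [T2Space X] (hI : MVInterInjectivity R M X)

/-- `Iᵏ × I → Iᵏ⁺¹`, `(x, t) ↦ (x, t)` (`Fin.snoc`), a continuous bijection. [folklore] -/
def snocCube (k : ℕ) : C((Fin k → I) × I, Fin (k + 1) → I) where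
  toFun p := Fin.snoc p.1 p.2
  continuous_toFun := Continuous.finSnoc continuous_fst continuous_snd

/-- `snocCube` is `Fin.snoc`. [folklore] -/
@[simp]
theorem snocCube_apply (k : ℕ) (p : (Fin k → I) × I) : snocCube k p = Fin.snoc p.1 p.2 := rfl

/-- `snocCube` is injective. [folklore] -/
theorem snocCube_injective (k : ℕ) : Function.Injective (snocCube k) := by
  rintro ⟨x, t⟩ ⟨x', t'⟩ hh
  obtain ⟨h1, h2⟩ :=
    Fin.snoc_inj.mp ((snocCube_apply k _).symm.trans (hh.trans (snocCube_apply k _)))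
  simp only at h1 h2
  rw [h1, h2]

/-- `snocCube` is surjective. [folklore] -/
theorem snocCube_surjective (k : ℕ) : Function.Surjective (snocCube k) :=
  fun q => ⟨(Fin.init q, q (Fin.last k)), Fin.snoc_init_self q⟩

/-- The slice `x ↦ (x, t)` of the cube, `Iᵏ → Iᵏ⁺¹`. [folklore] -/
def sliceCube (k : ℕ) (t : I) : C((Fin k → I), Fin (k + 1) → I) where
  toFun x := Fin.snoc x t
  continuous_toFun := Continuous.finSnoc continuous_id continuous_const

/-- `sliceCube k t` is `Fin.snoc · t`. [folklore] -/
@[simp]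
theorem sliceCube_apply (k : ℕ) (t : I) (x : Fin k → I) : sliceCube k t x = Fin.snoc x t := rfl

/-- `sliceCube k t` is injective. [folklore] -/
theorem sliceCube_injective (k : ℕ) (t : I) : Function.Injective (sliceCube k t) :=
  fun x y hh =>
    (Fin.snoc_inj.mp ((sliceCube_apply k t x).symm.trans (hh.trans (sliceCube_apply k t y)))).1

include hI in
/-- **Hatcher's Prop. 2B.1(a), positive degrees: the complement of an embedded cube in `X` has
no homology in positive degrees**, for a Hausdorff space `X` whose punctured open subsets
`X ∖ {x}` have no homology in positive degrees (e.g. `X = 𝕊ⁿ`): for every continuous injection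
`h : Iᵏ → X`, `Hⱼ(X ∖ h(Iᵏ); M) = 0` for `j ≠ 0`. By induction on `k`, the inductive step being
`isZero_slabCompl_univ` (Hatcher, *Algebraic Topology*, Prop. 2B.1(a); stated there for
`X = Sⁿ` and `h` an embedding of `Dᵏ ≅ Iᵏ`). Relies on the Mayer–Vietoris injectivity criterion
for `X` (`hI : MVInterInjectivity R M X`), taken as a hypothesis.
[cite: HatcherAT2002, Prop. 2B.1(a)] -/
theorem isZero_compl_range_cube
    (hpt : ∀ (x : X) (j : ℕ), j ≠ 0 → IsZero (singularHomology R M ↥({x}ᶜ : Set X) j)) (k : ℕ) :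
    ∀ (h : C((Fin k → I), X)), Injective h → ∀ (j : ℕ), j ≠ 0 →
      IsZero (singularHomology R M ↥(range h)ᶜ j) := by
  induction k with
  | zero =>
    intro h hinj j hj
    rw [range_unique]
    exact hpt _ j hj
  | succ k ih =>
    intro h hinj j hj
    let h' : C((Fin k → I) × I, X) := h.comp (snocCube k)
    have hinj' : Injective h' := hinj.comp (snocCube_injective k)
    have hr : slabCompl h' univ = (range h)ᶜ := by
      rw [slabCompl_univ, ContinuousMap.coe_comp, range_comp, (snocCube_surjective k).range_eq,
        image_univ]
    rw [← hr]
    refine isZero_slabCompl_univ h' hI hinj' (fun t j hj => ?_) hj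
    rw [slabCompl_singleton]
    exact ih (h.comp (sliceCube k t)) (hinj.comp (sliceCube_injective k t)) j hj

end Cubes

section Spheres

variable {R : Type v} [CommRing R] {M : Type v} [AddCommGroup M] [Module R M]
variable (hS : isZero_singularHomology_sphere R M)

/-- A punctured sphere has no homology in positive degrees (`𝕊ⁿ ∖ {x} ≃ₜ ℝⁿ` is contractible).
[folklore] -/
theorem isZero_compl_singleton_sphere {n : ℕ} (x : 𝕊 n) {j : ℕ} (hj : j ≠ 0) :
    IsZero (singularHomology R M ↥({x}ᶜ : Set (𝕊 n)) j) :=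
  (isZero_singularHomology_of_contractibleSpace R M (X := 𝔼 n) hj).of_iso
    (singularHomology.mapIso R M (sphereMinusPointHomeomorph x) j)

include hS in
/-- A twice punctured `(n+1)`-sphere has the homology of `𝕊ⁿ`: `Hᵢ(𝕊ⁿ⁺¹ ∖ {v, w}; M) = 0` for
`i ≠ 0, n` (`𝕊ⁿ⁺¹ ∖ {v, w} ≃ₜ ℝⁿ⁺¹ ∖ {0} ≃ 𝕊ⁿ`, `sphereMinusTwoPointsHomeomorph`,
`sphereHomotopyEquivPunctured`), granted the homology of spheres `isZero_singularHomology_sphere`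
(hypothesis `hS`). [cite: HatcherAT2002, Prop. 2B.1(b), case k = 0] -/
theorem isZero_compl_pair_sphere {n : ℕ} (v w : 𝕊 (n + 1)) (hw : w ≠ v) {i : ℕ} (hi0 : i ≠ 0)
    (hin : i ≠ n) : IsZero (singularHomology R M ↥(({v, w} : Set (𝕊 (n + 1)))ᶜ) i) :=
  (hS hi0 hin).of_iso (singularHomology.mapIso R M (sphereMinusTwoPointsHomeomorph v w hw) i ≪≫
    (singularHomology.isoOfHomotopyEquiv R M (sphereHomotopyEquivPunctured (n + 1)) i).symm)

include hS in
/-- **Hatcher's Prop. 2B.1(b), vanishing part**, for continuous injections: for `k < n` and a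
continuous injection `f : 𝕊ᵏ → 𝕊ⁿ`, `Hᵢ(𝕊ⁿ ∖ f(𝕊ᵏ); M) = 0` for `i ≠ 0, n - k - 1`. Induction on
`k`: for `k = 0` the complement of two points of `𝕊ⁿ` is `ℝⁿ ∖ {0} ≃ 𝕊ⁿ⁻¹`; for the inductive
step write `𝕊ᵏ⁺¹ = D₊ ∪ D₋` (closed hemispheres, cubes) with `D₊ ∩ D₋ = 𝕊ᵏ` (equator): then
`𝕊ⁿ ∖ f(𝕊ᵏ) = (𝕊ⁿ ∖ f(D₊)) ∪ (𝕊ⁿ ∖ f(D₋))` with intersection `𝕊ⁿ ∖ f(𝕊ᵏ⁺¹)`, the two pieces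
have no positive-degree homology by part (a) (`isZero_compl_range_cube`), and Mayer–Vietoris
gives `Hᵢ(𝕊ⁿ ∖ f(𝕊ᵏ⁺¹)) ↞ Hᵢ₊₁(𝕊ⁿ ∖ f(𝕊ᵏ)) = 0` (Hatcher, *Algebraic Topology*, Prop. 2B.1(b)).
Relies on the Mayer–Vietoris injectivity criterion for the target sphere `𝕊ⁿ`
(`MVInterInjectivity R M (𝕊 n)`, which implies the vanishing criterion) and the homology of
spheres (`hS`), taken as hypotheses. [cite: HatcherAT2002, Prop. 2B.1(b)] -/
theorem isZero_compl_range_sphere (k : ℕ) :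
    ∀ {n : ℕ} (_ : MVInterInjectivity R M (𝕊 n)) (f : C(𝕊 k, 𝕊 n)), Injective f → k < n →
      ∀ {i : ℕ}, i ≠ 0 → i ≠ n - k - 1 → IsZero (singularHomology R M ↥(range f)ᶜ i) := by
  induction k with
  | zero =>
    intro n hI f hf hkn i hi0 hin
    obtain ⟨n, rfl⟩ : ∃ n', n = n' + 1 := ⟨n - 1, by omega⟩
    rw [range_eq_pair_of_sphere_zero]
    refine isZero_compl_pair_sphere hS _ _ (fun h => pole_one_ne_pole_neg_one (hf h).symm) hi0 ?_
    simpa using hin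
  | succ k ih =>
    intro n hI f hf hkn i hi0 hin
    -- the two closed hemispheres and their complements
    let g : ∀ (ε : ℝ) (_ : ε ^ 2 = 1), C((Fin (k + 1) → I), 𝕊 n) := fun ε hε =>
      f.comp ⟨hemisphere ε hε, continuous_hemisphere ε hε⟩
    have hg : ∀ (ε : ℝ) (hε : ε ^ 2 = 1), Injective (g ε hε) := fun ε hε =>
      hf.comp (hemisphere_injective ε hε)
    have hgo : ∀ (ε : ℝ) (hε : ε ^ 2 = 1), IsOpen (range (g ε hε))ᶜ := fun ε hε =>
      (isCompact_range (g ε hε).continuous).isClosed.isOpen_compl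
    have hgr : ∀ (ε : ℝ) (hε : ε ^ 2 = 1), range (g ε hε) = f '' range (hemisphere ε hε) :=
      fun ε hε => range_comp f (hemisphere ε hε)
    have h1 : (1 : ℝ) ^ 2 = 1 := by norm_num
    have h1' : (-1 : ℝ) ^ 2 = 1 := by norm_num
    have hW : (range (g 1 h1))ᶜ ∩ (range (g (-1) h1'))ᶜ = (range f)ᶜ := by
      rw [← compl_union, hgr, hgr, ← image_union, range_hemisphere_union_range_hemisphere,
        image_univ]
    let e : C(𝕊 k, 𝕊 n) := f.comp ⟨equator, continuous_equator⟩
    have hY : (range (g 1 h1))ᶜ ∪ (range (g (-1) h1'))ᶜ = (range e)ᶜ := by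
      rw [← compl_inter, hgr, hgr, ← image_inter hf, range_hemisphere_inter_range_hemisphere,
        ← range_equator, ← range_comp]
      rfl
    refine hI.mvInterVanishing.of_eq (hgo 1 h1) (hgo (-1) h1') hW hY i ?_ ?_ ?_
    · exact isZero_compl_range_cube hI isZero_compl_singleton_sphere (k + 1)
        (g 1 h1) (hg 1 h1) i hi0
    · exact isZero_compl_range_cube hI isZero_compl_singleton_sphere (k + 1)
        (g (-1) h1') (hg (-1) h1') i hi0
    · exact ih hI e (hf.comp equator_injective) (by omega) (i.succ_ne_zero) (by omega)

include hS in
/-- **Hatcher's Prop. 2B.1(b), vanishing part: `Hᵢ(𝕊ⁿ ∖ h(𝕊ᵏ); M) = 0` for an embedding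
`h : 𝕊ᵏ → 𝕊ⁿ`, `k < n`, and `i ≠ 0, n - k - 1`**, granted the Mayer–Vietoris injectivity criterion
for `𝕊ⁿ` and the homology of spheres. (For `i = n - k - 1` the reduced homology is `M`, by the
same induction; not needed here.) [cite: HatcherAT2002, Prop. 2B.1(b)] -/
theorem isZero_compl_range_of_isEmbedding_of_criteria {k n i : ℕ}
    (hI : MVInterInjectivity R M (𝕊 n)) (h : 𝕊 k → 𝕊 n) (he : Topology.IsEmbedding h)
    (hkn : k < n) (hi0 : i ≠ 0) (hin : i ≠ n - k - 1) :
    IsZero (singularHomology R M ↥((range h)ᶜ : Set (𝕊 n)) i) :=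
  isZero_compl_range_sphere hS k hI ⟨h, he.continuous⟩ he.injective hkn hi0 hin

/-- **Hatcher's Prop. 2B.1(b), vanishing part: `Hᵢ(𝕊ⁿ ∖ h(𝕊ᵏ); M) = 0` for an embedding
`h : 𝕊ᵏ → 𝕊ⁿ`, `k < n`, and `i ≠ 0, n - k - 1`.** This is the statement of the named fact
`Literature.Topology.FourManifolds.isZero_singularHomology_sphere_compl_sphere` of
`Literature/Topology/FourManifolds/GluckTwistHomology.lean` (there with `ℤ` coefficients), modulo
excision, Mayer–Vietoris exactness and the homology of spheres (`hexc`, `h₃`, `hS`: the named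
facts of `ExcisionMayerVietoris.lean`), via `isZero_compl_range_of_isEmbedding_of_criteria` and
`mvInterInjectivity_of_mayerVietoris`. [cite: HatcherAT2002, Prop. 2B.1(b)] -/
theorem isZero_compl_range_of_isEmbedding
    (hexc : ∀ (T : Type) [TopologicalSpace T],
      relativeSingularHomology.isIso_map_of_interior_union_interior R M T)
    (h₃ : ∀ (T : Type) [TopologicalSpace T] (U V : Set T), mayerVietoris.exact₃ R M U V)
    (hS : isZero_singularHomology_sphere R M) {k n i : ℕ} (h : 𝕊 k → 𝕊 n)
    (he : Topology.IsEmbedding h) (hkn : k < n) (hi0 : i ≠ 0) (hin : i ≠ n - k - 1) :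
    IsZero (singularHomology R M ↥((range h)ᶜ : Set (𝕊 n)) i) :=
  isZero_compl_range_of_isEmbedding_of_criteria hS (mvInterInjectivity_of_mayerVietoris R M hexc h₃)
    h he hkn hi0 hin

end Spheres

end SphereComplement

end Literature.AlgebraicTopology.SingularHomology
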